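import Literature.NumberTheory.GaloisRepresentations.PowLocallyAlgebraicProofs
import Literature.NumberTheory.GaloisRepresentations.HeckeCharacterGaloisAvatarProofs
import Literature.NumberTheory.GaloisRepresentations.TateTwistFrobeniusProofs
import Literature.NumberTheory.GaloisRepresentations.WeakAbelianDirectSummandCyclotomicProofs
import Literature.NumberTheory.GaloisRepresentations.LAdicRepFrobenius
import Literature.NumberTheory.GaloisRepresentations.FramedRepEquivConj
import Literature.NumberTheory.Automorphic.ChebotarevArtinRepHolds
import Summits.Langlands.Langlands.Theorems.IrreducibilityBySelfDualityReciprocityUpToIrreducibilityHeckeParallelOfRealPlace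
import Summits.Langlands.Langlands.Theorems.IrreducibilityBySelfDualityReciprocityUpToIrreducibilityHeckeParallelNormTwist
import Summits.Langlands.Langlands.Theorems.IrreducibilityBySelfDualityReciprocityUpToIrreducibilityHeckeTypeZeroFiniteOrder
import HarnessLib

/-!
# Line `Sketch` for the crux `ReciprocityUpToIrreducibility` (item stmt-Langlands-14328), wave N15-E:
# over a number field with a real place every `E`-rational rank-one `ℓ`-adic `ρ` is `(open kernel) ⊗ ε_ℓ^k`

Support file (closes nothing; stub `stub_rankOne_eq_twist_of_isRationalOver` of the registered
skeleton of line `Sketch`, continuation lead c10).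

Let `K` be a number field with a real place, `ℓ` a prime, `ι : ℚ̄_ℓ ≃+* ℂ`, `E ⊂ ℚ̄_ℓ` a number
field (`e : E →+* ℚ̄_ℓ`) and `ρ : Γ_K → GL₁(ℚ̄_ℓ)` an `E`-RATIONAL continuous character
(`FramedGaloisRep.IsRationalOver e`, Böckle–Hui §2.1).  Then, as a framed representation,
`ρ = r ⊗ ε` (`FramedRep.twist`, an EQUALITY) where `r` has open kernel and carries the Frobenius
data of a finite-order Hecke character `χ₀` and `ε = ε_ℓ^k` is an integral power of the cyclotomic
character:

* `ρ` is semisimple (`FramedGaloisRep.isSemisimple_toGaloisRep_of_rank_one`) and weakly divides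
  itself (`FramedGaloisRep.weaklyDivides_self_of_eventually_isUnramifiedAt`), so Böckle–Hui 2025,
  Thm. 1.1 (PROVED in the tree, `exists_heckeCharacter_of_weaklyDivides_holds`) gives an ALGEBRAIC
  Hecke character `χ` with `char ρ(Frob_v^{arith}) = X - ι⁻¹(χ(ϖ_v))⁻¹` almost everywhere
  (the chain of c9's `rankOne_weakAutomorphy_of_isRationalOver`, wave N12-R);
* `χ` has an infinity type `(p, q)` (`HeckeCharacter.isAlgebraic_iff_exists_hasInfinityType`),
  parallel since `K` has a real place (N11-G `stub_infinityType_parallel_of_isReal`), so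
  `χ₀ := χ · ‖·‖^m` has type `(0, 0)` for some `m ∈ ℤ` (N11-B
  `stub_normTwist_hasInfinityType_zero_of_parallel`) and is of finite order (N11-A
  `stub_isFiniteOrder_of_hasInfinityType_zero`);
* `r` := the open-kernel `ℓ`-adic avatar of `χ₀` (`FramedArtinRep.lAdicAvatar` of the Artin character
  of `χ₀`, `HeckeCharacter.exists_framedArtinRep_of_isFiniteOrder`; c8's
  `exists_lAdic_of_isFiniteOrder_isOpen_ker`), `ε := ε_ℓ^{-m}`
  (`exists_cyclotomicCharacter_padicAlgCl_zpow`);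
* at almost every place `v` (`v ∤ ℓ`, `χ` and `ρ` unramified), `ρ` and `r ⊗ ε` are unramified with
  the SAME Frobenius polynomial `X - q_v^{-m} ι⁻¹(χ₀(ϖ_v))⁻¹ = X - ι⁻¹(χ(ϖ_v))⁻¹`
  (`χ(ϖ_v) = χ₀(ϖ_v) q_v^{m}` by `valueAtUniformizer_normCharacter`; twist bookkeeping
  `isUnramifiedAt_twist`, `eq_one_of_mem_inertia_of_cyclotomic_zpow`,
  `hasFrobCharpolyAt_twist_of_eq_prod`, `coe_apply_of_isArithFrobAt_of_cyclotomic_zpow`), hence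
  they are equivalent by Chebotarev (`FramedGaloisRep.nonempty_equiv_of_hasFrobCharpolyAt_eventually`
  with `chebotarev_artinRep_holds`), hence conjugate (`FramedRep.exists_eq_conj_of_equiv`), hence
  EQUAL in rank one (`conj_eq_self_of_rank_one`).

References: G. Böckle, C.-Y. Hui, Math. Ann. 393 (2025), Thm. 1.1 [BockleHui2025]; A. Weil,
*On a certain type of characters of the idèle-class group of an algebraic number-field* (1956), §1
[Weil1956]; J.-P. Serre, *Abelian ℓ-adic representations and elliptic curves* (1968), Ch. I §1.2,
Ch. III §2.3, §3 [SerreAbelianLadic1968]; P. Deligne, J.-P. Serre, ASENS 7 (1974), Lemme 3.2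
[DeligneSerreASENS1974].

To keep this file independent of `Summits.Langlands.Langlands.Theses.IrreducibilityBySelfDuality`
(and so of the c3–c8 sector files importing it) it carries PRIVATE copies of four small tree lemmas:
c8's `isOpen_ker_lAdicAvatar` / `exists_lAdic_of_isFiniteOrder_isOpen_ker` (`…RankOneAllPlaces`,
`…WeakExistenceAll`), c3's `heckeCharacter_zpow_apply` (`…WeakExistenceNormTwist`) and c7's
`conj_eq_self_of_rank_one` (`…ArtinLocalGlobal`).

No definitions; standard axioms only; no named fact.
-/

noncomputable section

set_option linter.dupNamespace false -- project-wide option (lakefile weak.linter.dupNamespace); `Summit.Langlands.Langlands` is the mandated namespace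

open scoped NumberField Classical Polynomial MatrixGroups
open Filter IsDedekindDomain Polynomial
open Literature.NumberTheory.Automorphic Literature.NumberTheory.GaloisRepresentations
open Summit.Langlands

namespace Summit.Langlands.Langlands.Theorems.ReciprocityUpToIrreducibility

variable {K : Type} [Field K] [NumberField K] {ℓ : ℕ} [Fact ℓ.Prime]

/-! ## 0. Private copies of four small tree lemmas (see the module docstring) -/

/-- Integer powers of Hecke characters are pointwise: `(χ ^ k) x = (χ x) ^ k` (private copy of c3's
`heckeCharacter_zpow_apply` of `…WeakExistenceNormTwist`). [folklore] -/
private theorem heckeCharacter_zpow_apply_aux (χ : HeckeCharacter K) (k : ℤ) (x : ideleGroup K) :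
    (χ ^ k) x = (χ x) ^ k := by
  rcases k with (n | n)
  · rw [Int.ofNat_eq_natCast, zpow_natCast, zpow_natCast, HeckeCharacter.pow_apply]
  · rw [zpow_negSucc, zpow_negSucc, HeckeCharacter.inv_apply, HeckeCharacter.pow_apply]

/-- The `ℓ`-adic avatar of a rank-one Artin representation has open kernel (the kernel of `ψ`;
private copy of c8's `isOpen_ker_lAdicAvatar` of `…RankOneAllPlaces`).
[cite: SerreAbelianLadic1968, Ch. III §2.3] -/
private theorem isOpen_ker_lAdicAvatar_aux (ψ : FramedArtinRep K 1) (ι : PadicAlgCl ℓ ≃+* ℂ) :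
    IsOpen ((ψ.lAdicAvatar ι).toMonoidHom.ker : Set (Field.absoluteGaloisGroup K)) := by
  have h : ((ψ.lAdicAvatar ι).toMonoidHom.ker : Set (Field.absoluteGaloisGroup K)) =
      ((ψ.lAdicChar ι).ker : Set (Field.absoluteGaloisGroup K)) := by
    ext σ
    simp only [SetLike.mem_coe, MonoidHom.mem_ker]
    exact FramedGaloisRep.ofOpenKer_apply_eq_one_iff (ψ.lAdicChar ι) (ψ.isOpen_ker_lAdicChar ι) σ
  rw [h]
  exact ψ.isOpen_ker_lAdicChar ι

/-- **The `ℓ`-adic avatar of a finite-order Hecke character, with open kernel** (private copy of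
c8's `exists_lAdic_of_isFiniteOrder_isOpen_ker` of `…WeakExistenceAll`): for `χ₀` of finite order and
`ι : ℚ̄_ℓ ≃+* ℂ` there is `r : Γ_K → GL_1(ℚ̄_ℓ)` with OPEN KERNEL, unramified at `v` iff `χ₀` is, with
`char r(Frob_v^{arith}) = X - ι⁻¹(χ₀(ϖ_v))⁻¹` at every such `v` — the avatar
`FramedArtinRep.lAdicAvatar` of the Artin character of `χ₀`
(`HeckeCharacter.exists_framedArtinRep_of_isFiniteOrder`).
[cite: SerreAbelianLadic1968, Ch. III §2.3] [cite: CasselsFrohlichANT1967, Ch. VII §5.1 Main Theorem] -/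
private theorem exists_lAdic_of_isFiniteOrder_isOpen_ker_aux (χ₀ : HeckeCharacter K)
    (hfin : χ₀.IsFiniteOrder) (ι : PadicAlgCl ℓ ≃+* ℂ) :
    ∃ r : FramedGaloisRep K (PadicAlgCl ℓ) 1,
      IsOpen (r.toMonoidHom.ker : Set (Field.absoluteGaloisGroup K)) ∧
      (∀ v : HeightOneSpectrum (𝓞 K), r.IsUnramifiedAt v ↔ χ₀.IsUnramifiedAt v) ∧
      ∀ v : HeightOneSpectrum (𝓞 K), χ₀.IsUnramifiedAt v →
        r.HasFrobCharpolyAt v (X - C (ι.symm (χ₀.valueAtUniformizer v)⁻¹)) := by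
  obtain ⟨ψ, hram, hfrob⟩ := χ₀.exists_framedArtinRep_of_isFiniteOrder hfin
  exact ⟨ψ.lAdicAvatar ι, isOpen_ker_lAdicAvatar_aux ψ ι,
    fun v => (ψ.isUnramifiedAt_lAdicAvatar_iff ι v).trans (hram v),
    fun v hv => ψ.hasFrobCharpolyAt_lAdicAvatar ι (hfrob v hv)⟩

/-- Conjugation is trivial on rank-one framed representations (`GL₁` is commutative; private copy of
c7's `conj_eq_self_of_rank_one` of `…ArtinLocalGlobal`). [folklore] -/
private theorem conj_eq_self_of_rank_one_aux {G A : Type*} [Group G] [TopologicalSpace G] [CommRing A]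
    [TopologicalSpace A] [IsTopologicalRing A] (P : GL (Fin 1) A) (ρ : FramedRep G A 1) :
    ρ.conj P = ρ := by
  refine DFunLike.ext _ _ fun g => ?_
  rw [FramedRep.conj_apply]
  have hcomm : P * ρ g = ρ g * P := by
    refine Units.ext ?_
    rw [Units.val_mul, Units.val_mul]
    ext i j
    fin_cases i; fin_cases j
    simp [Matrix.mul_apply, mul_comm]
  rw [hcomm, mul_inv_cancel_right]

/-! ## 1. Norm twists of Hecke characters; rank-one rigidity -/

/-- **A norm twist of a Hecke character has the same ramification**: `χ · ‖·‖^m` is unramified at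
`v` iff `χ` is (`‖·‖` is unramified everywhere, `HeckeCharacter.isUnramifiedAt_normCharacter`;
the computation inside c8's `weakExistence_rankOne_of_isFiniteOrder_normTwist_all`).
[cite: TateThesis1967, §2.3] -/
private theorem isUnramifiedAt_mul_normCharacter_zpow_iff (χ : HeckeCharacter K) (m : ℤ)
    (v : HeightOneSpectrum (𝓞 K)) :
    (χ * HeckeCharacter.normCharacter K ^ m).IsUnramifiedAt v ↔ χ.IsUnramifiedAt v := by
  refine forall_congr' fun u => ?_
  have h2 := HeckeCharacter.isUnramifiedAt_normCharacter v u
  rw [HeckeCharacter.localComponent_apply] at h2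
  rw [HeckeCharacter.localComponent_apply, HeckeCharacter.localComponent_apply,
    HeckeCharacter.mul_apply, heckeCharacter_zpow_apply_aux, h2, one_zpow, mul_one]

/-- **The value at a uniformiser of a norm twist**: `(χ · ‖·‖^m)(ϖ_v) = χ(ϖ_v) · q_v^{-m}`
(`‖ϖ_v‖ = q_v⁻¹`, `HeckeCharacter.valueAtUniformizer_normCharacter`).
[cite: TateThesis1967, §2.5] -/
private theorem valueAtUniformizer_mul_normCharacter_zpow (χ : HeckeCharacter K) (m : ℤ)
    (v : HeightOneSpectrum (𝓞 K)) :
    (χ * HeckeCharacter.normCharacter K ^ m).valueAtUniformizer v =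
      χ.valueAtUniformizer v * ((v.residueCard : ℂ)⁻¹) ^ m := by
  rw [← HeckeCharacter.valueAtUniformizer_normCharacter v]
  simp only [HeckeCharacter.valueAtUniformizer, HeckeCharacter.localComponent_apply,
    HeckeCharacter.mul_apply, Units.val_mul, heckeCharacter_zpow_apply_aux, Units.val_zpow_eq_zpow_val]

/-- **Rank-one rigidity (Chebotarev): two rank-one `ℓ`-adic characters of `Γ_K`, unramified with
the same Frobenius characteristic polynomial at almost every place, are EQUAL.**  Both are
semisimple (`FramedGaloisRep.isSemisimple_toGaloisRep_of_rank_one`), hence equivalent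
(`FramedGaloisRep.nonempty_equiv_of_hasFrobCharpolyAt_eventually`, Deligne–Serre Lemme 3.2 from
Chebotarev `chebotarev_artinRep_holds`), hence conjugate (`FramedRep.exists_eq_conj_of_equiv`), and
conjugation is trivial on `GL₁` (c7's `conj_eq_self_of_rank_one`).
[cite: DeligneSerreASENS1974, Lemme 3.2] [cite: SerreAbelianLadic1968, Ch. I §2.3] -/
theorem eq_of_hasFrobCharpolyAt_eventually_rank_one (ρ ρ' : FramedGaloisRep K (PadicAlgCl ℓ) 1)
    (hev : ∀ᶠ v : HeightOneSpectrum (𝓞 K) in cofinite,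
      ρ.IsUnramifiedAt v ∧ ρ'.IsUnramifiedAt v ∧
        ∃ P : Polynomial (PadicAlgCl ℓ), ρ.HasFrobCharpolyAt v P ∧ ρ'.HasFrobCharpolyAt v P) :
    ρ' = ρ := by
  obtain ⟨e⟩ := FramedGaloisRep.nonempty_equiv_of_hasFrobCharpolyAt_eventually chebotarev_artinRep_holds
    ρ ρ' (FramedGaloisRep.isSemisimple_toGaloisRep_of_rank_one ρ)
    (FramedGaloisRep.isSemisimple_toGaloisRep_of_rank_one ρ') hev
  obtain ⟨P, hP⟩ := FramedRep.exists_eq_conj_of_equiv ρ ρ' e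
  rw [hP, conj_eq_self_of_rank_one_aux]

/-! ## 2. The stub -/

/-- **Over a field with a real place every `E`-rational rank-one `ρ` is `(open kernel) ⊗ ε_ℓ^k`**
(hypotheses as free variables).  For `ρ : Γ_K → GL₁(ℚ̄_ℓ)` `E`-rational and `K` with a real place
there are a finite-order Hecke character `χ₀`, `k ∈ ℤ`, an open-kernel `r` unramified exactly where
`χ₀` is and with `char r(Frob_v^{arith}) = X - ι⁻¹(χ₀(ϖ_v))⁻¹` there, and `ε = ε_ℓ^k`, with
`ρ = r ⊗ ε`: Böckle–Hui Thm. 1.1 (`exists_heckeCharacter_of_weaklyDivides_holds`) makes `ρ` the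
avatar of an algebraic `χ`; a real place forces `χ = χ₀ ‖·‖^{-m}` with `χ₀` of finite order (N11-G,
N11-B, N11-A); `r` from `exists_lAdic_of_isFiniteOrder_isOpen_ker`, `ε = ε_ℓ^{-m}`; `ρ` and
`r ⊗ ε` have the same Frobenius polynomial almost everywhere, hence are equal
(`eq_of_hasFrobCharpolyAt_eventually_rank_one`).
[cite: BockleHui2025, Theorem 1.1] [cite: Weil1956, §1] [cite: SerreAbelianLadic1968, Ch. III §2.3, §3] -/
theorem rankOne_eq_twist_of_isRationalOver (hK : ∃ w₀ : NumberField.InfinitePlace K, w₀.IsReal)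
    (ι : PadicAlgCl ℓ ≃+* ℂ) {E : Type} [Field E] [NumberField E] (e : E →+* PadicAlgCl ℓ)
    (ρ : FramedGaloisRep K (PadicAlgCl ℓ) 1) (hrat : ρ.IsRationalOver e) :
    ∃ (χ₀ : HeckeCharacter K) (k : ℤ) (r : FramedGaloisRep K (PadicAlgCl ℓ) 1)
      (ε : Field.absoluteGaloisGroup K →ₜ* (PadicAlgCl ℓ)ˣ),
      χ₀.IsFiniteOrder ∧ IsOpen (r.toMonoidHom.ker : Set (Field.absoluteGaloisGroup K)) ∧
      (∀ v : HeightOneSpectrum (𝓞 K), r.IsUnramifiedAt v ↔ χ₀.IsUnramifiedAt v) ∧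
      (∀ v : HeightOneSpectrum (𝓞 K), χ₀.IsUnramifiedAt v →
        r.HasFrobCharpolyAt v (X - C (ι.symm (χ₀.valueAtUniformizer v)⁻¹))) ∧
      (∀ σ, (ε σ : PadicAlgCl ℓ) =
        (algebraMap ℚ_[ℓ] (PadicAlgCl ℓ) ((GaloisRep.cyclotomicCharacter K ℓ σ : ℤ_[ℓ]ˣ) : ℤ_[ℓ])) ^ k) ∧
      ρ = r.twist ε := by
  classical
  -- Böckle–Hui, Thm. 1.1: `ρ` is the avatar of an algebraic Hecke character `χ`
  have hss : ρ.toGaloisRep.IsSemisimple := FramedGaloisRep.isSemisimple_toGaloisRep_of_rank_one ρ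
  have hwd : ρ.WeaklyDivides ρ :=
    FramedGaloisRep.weaklyDivides_self_of_eventually_isUnramifiedAt hrat.eventually_isUnramifiedAt
  obtain ⟨χ, hχalg, hχ⟩ :=
    exists_heckeCharacter_of_weaklyDivides_holds K ℓ 1 E e ρ hss hrat ρ hwd ι
  -- a real place: `χ₀ := χ ‖·‖^m` is of finite order
  obtain ⟨p, q, hinf⟩ := (HeckeCharacter.isAlgebraic_iff_exists_hasInfinityType χ).1 hχalg
  obtain ⟨m, hm⟩ := stub_normTwist_hasInfinityType_zero_of_parallel K χ p q hinf
    (stub_infinityType_parallel_of_isReal K hK χ p q hinf)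
  have hfin : (χ * HeckeCharacter.normCharacter K ^ m).IsFiniteOrder :=
    stub_isFiniteOrder_of_hasInfinityType_zero K _ hm
  -- the open-kernel avatar `r` of `χ₀` and `ε = ε_ℓ^{-m}`
  obtain ⟨r, hker, hram, hfrob⟩ :=
    exists_lAdic_of_isFiniteOrder_isOpen_ker_aux (χ * HeckeCharacter.normCharacter K ^ m) hfin ι
  obtain ⟨ε, hε⟩ := exists_cyclotomicCharacter_padicAlgCl_zpow K ℓ (-m)
  refine ⟨χ * HeckeCharacter.normCharacter K ^ m, -m, r, ε, hfin, hker, hram, hfrob, hε, ?_⟩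
  -- `ρ` and `r ⊗ ε` have the same Frobenius polynomial at almost every place
  refine eq_of_hasFrobCharpolyAt_eventually_rank_one (r.twist ε) ρ ?_
  filter_upwards [hχ, FramedGaloisRep.eventually_natCast_not_mem K ℓ] with v hv hvℓ
  obtain ⟨hurχ, hurρ, hfrobρ⟩ := hv
  have hur₀ : (χ * HeckeCharacter.normCharacter K ^ m).IsUnramifiedAt v :=
    (isUnramifiedAt_mul_normCharacter_zpow_iff χ m v).2 hurχ
  refine ⟨FramedGaloisRep.isUnramifiedAt_twist ((hram v).2 hur₀)
    (fun 𝔓 h𝔓 σ hσ => eq_one_of_mem_inertia_of_cyclotomic_zpow hε hvℓ h𝔓 hσ), hurρ,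
    X - C (ι.symm (χ.valueAtUniformizer v)⁻¹), ?_, hfrobρ⟩
  -- `char (r ⊗ ε)(Frob_v) = X - q_v^{-m} ι⁻¹(χ₀(ϖ_v))⁻¹ = X - ι⁻¹(χ(ϖ_v))⁻¹`
  have h0 : r.HasFrobCharpolyAt v
      (({ι.symm ((χ * HeckeCharacter.normCharacter K ^ m).valueAtUniformizer v)⁻¹} :
        Multiset (PadicAlgCl ℓ)).map fun b => X - C b).prod := by
    rw [Multiset.map_singleton, Multiset.prod_singleton]
    exact hfrob v hur₀
  have htw := FramedGaloisRep.hasFrobCharpolyAt_twist_of_eq_prod h0 (χ := ε)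
    (c := (v.residueCard : PadicAlgCl ℓ) ^ (-m))
    (fun 𝔓 h𝔓 σ hσ => coe_apply_of_isArithFrobAt_of_cyclotomic_zpow hε hvℓ h𝔓 hσ)
  rw [Multiset.map_singleton, Multiset.prod_singleton] at htw
  have hq : (v.residueCard : PadicAlgCl ℓ) ≠ 0 :=
    Nat.cast_ne_zero.2 (Nat.one_lt_iff_ne_zero_and_ne_one.1 v.one_lt_residueCard).1
  have hroot : (v.residueCard : PadicAlgCl ℓ) ^ (-m) *
      ι.symm ((χ * HeckeCharacter.normCharacter K ^ m).valueAtUniformizer v)⁻¹ =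
        ι.symm (χ.valueAtUniformizer v)⁻¹ := by
    rw [valueAtUniformizer_mul_normCharacter_zpow, mul_inv, inv_zpow, inv_inv, map_mul, map_zpow₀,
      map_natCast, mul_comm (ι.symm (χ.valueAtUniformizer v)⁻¹), ← mul_assoc, zpow_neg,
      inv_mul_cancel₀ (zpow_ne_zero m hq), one_mul]
  rw [hroot] at htw
  exact htw

/-- **Registered stub `stub_rankOne_eq_twist_of_isRationalOver` of line `Sketch` (crux
stmt-Langlands-14328, wave N15-E), closed form of `rankOne_eq_twist_of_isRationalOver`** (all
binders explicit, in the order `K, hK, ℓ, ι, E, e, ρ`): over a number field with a real place every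
`E`-rational `ρ : Γ_K → GL₁(ℚ̄_ℓ)` equals `r ⊗ ε_ℓ^k` with `r` the open-kernel avatar of a
finite-order Hecke character `χ₀` (carrying its Frobenius data) and `k ∈ ℤ`.
[cite: BockleHui2025, Theorem 1.1] [cite: Weil1956, §1] [cite: SerreAbelianLadic1968, Ch. III §2.3, §3] -/
theorem stub_rankOne_eq_twist_of_isRationalOver :
    ∀ (K : Type) [Field K] [NumberField K], (∃ w₀ : NumberField.InfinitePlace K, w₀.IsReal) →
      ∀ (ℓ : ℕ) [Fact ℓ.Prime] (ι : PadicAlgCl ℓ ≃+* ℂ) (E : Type) [Field E] [NumberField E]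
        (e : E →+* PadicAlgCl ℓ) (ρ : FramedGaloisRep K (PadicAlgCl ℓ) 1), ρ.IsRationalOver e →
        ∃ (χ₀ : HeckeCharacter K) (k : ℤ) (r : FramedGaloisRep K (PadicAlgCl ℓ) 1)
          (ε : Field.absoluteGaloisGroup K →ₜ* (PadicAlgCl ℓ)ˣ),
          χ₀.IsFiniteOrder ∧ IsOpen (r.toMonoidHom.ker : Set (Field.absoluteGaloisGroup K)) ∧
          (∀ v : HeightOneSpectrum (𝓞 K), r.IsUnramifiedAt v ↔ χ₀.IsUnramifiedAt v) ∧
          (∀ v : HeightOneSpectrum (𝓞 K), χ₀.IsUnramifiedAt v →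
            r.HasFrobCharpolyAt v (X - C (ι.symm (χ₀.valueAtUniformizer v)⁻¹))) ∧
          (∀ σ, (ε σ : PadicAlgCl ℓ) =
            (algebraMap ℚ_[ℓ] (PadicAlgCl ℓ) ((GaloisRep.cyclotomicCharacter K ℓ σ : ℤ_[ℓ]ˣ) : ℤ_[ℓ])) ^ k) ∧
          ρ = r.twist ε :=
  fun _ _ _ hK _ _ ι _ _ _ e ρ hrat => rankOne_eq_twist_of_isRationalOver hK ι e ρ hrat

end Summit.Langlands.Langlands.Theorems.ReciprocityUpToIrreducibility

end
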